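import Literature.Probability.Percolation.ConstrainedClusters
import Literature.Probability.Percolation.ConnectivityThetaSqProofs
import Literature.Probability.Percolation.UniquenessInfiniteCluster
import Literature.Probability.Percolation.SharpnessDCTProofs
import HarnessLib

/-!
# `stub_mirrorTwoGhost` — the mirror two-arm event lies in Hutchcroft's two-cluster event

Crux `Summit.CriticalPhenomena.PercolationContinuityZ3.Theses.PercLowPointHalfSpace.QuantitativeBGN`
(item stmt-CriticalPhenomena-0913), line `mirror-akn-two-arm-import`, stub `stub_mirrorTwoGhost`
(STUB 2 of the line's skeleton).

Statement proved (for every `p ∈ [0,1]` and every `n : ℕ`), for bond percolation on `ℤ³`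
(`bondPercolation (zdGraph 3) p`), with `e₀ = Pi.single 0 1`, `H⁺ = {x | 1 ≤ x 0}`,
`H⁻ = {x | x 0 ≤ 0}` and `C_R(x) = openClusterIn (withinGraph (zdGraph 3) R) ω x` the open cluster
of `x` using only lattice steps inside `R`:

`P_p(n ≤ |C_{H⁺}(e₀)|, n ≤ |C_{H⁻}(0)|, 0 ↮ e₀) ≤ P_p(𝒮_{e,n})`,

where `𝒮_{e,n}` is VERBATIM the event of `Hutchcroft2020_twoGhost_corollary`
(`TwoGhostInequality.lean`) at `d = 3`, `x = 0`, `y = e₀`: the edge `e = s(0, e₀)` is closed, the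
bulk clusters of `0` and `e₀` are distinct, each touches at least `n` lattice edges, and at least
one of them is finite.

Proof. The inclusion of events holds almost surely:
* `s(0, e₀) ∈ ω` would make `0 ∼ e₀` in the open graph, contradicting `0 ↮ e₀`;
* the constrained clusters are contained in the bulk clusters
  (`openClusterIn_subset_openCluster`), and `v ↦ s(v, v + e₀)` injects any set of sites into the
  lattice edges meeting it (`MirrorTwoGhost.encard_le_encard_edges_meeting`), so each bulk cluster
  touches at least `n` edges;
* almost surely there is at most one infinite open cluster
  (`Grimmett1999_numInfiniteClusters_le_one_holds 3 p`), and two infinite bulk clusters at `0` and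
  `e₀` would then be joined (`mem_openConn_of_numInfiniteClusters_le_one`), contradicting `0 ↮ e₀`;
  hence one of them is finite.
The measured form follows from `measure_mono_ae`.
-/

noncomputable section

namespace Summit.CriticalPhenomena.PercolationContinuityZ3.Theorems

open MeasureTheory Literature.Probability.Percolation Literature.Probability.LatticeModels

namespace MirrorTwoGhost

/-- **Sites inject into the lattice edges meeting them.** For a coordinate direction `i` of `ℤ^d`
and sets of sites `S ⊆ T`, the map `v ↦ s(v, v + eᵢ)` sends `S` injectively into the set of edges
of `ℤ^d` having an endpoint in `T`; hence `|S| ≤ |{e ∈ E(ℤ^d) | e meets T}|` (in `ℕ∞`). -/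
theorem encard_le_encard_edges_meeting {d : ℕ} (i : Fin d) {S T : Set (Site d)} (hST : S ⊆ T) :
    S.encard ≤ {e ∈ (zdGraph d).edgeSet | ∃ v ∈ e, v ∈ T}.encard := by
  refine Set.encard_le_encard_of_injOn (f := fun v : Site d => s(v, v + Pi.single i 1)) ?_ ?_
  · intro v hv
    refine ⟨?_, v, Sym2.mem_mk_left _ _, hST hv⟩
    rw [SimpleGraph.mem_edgeSet, zdGraph_adj_iff]
    exact ⟨i, Or.inl rfl⟩
  · intro v _ v' _ h
    rcases Sym2.eq_iff.1 h with ⟨h1, -⟩ | ⟨h1, h2⟩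
    · exact h1
    · exfalso
      have h1i := congrFun h1 i
      have h2i := congrFun h2 i
      simp only [Pi.add_apply, Pi.single_eq_same] at h1i h2i
      omega

/-- `0 ≠ e₀` in `ℤ³` (evaluate at the first coordinate). -/
theorem zero_ne_e0 : (0 : Site 3) ≠ Pi.single 0 1 := by
  intro h
  simpa using congrFun h 0

end MirrorTwoGhost

open MirrorTwoGhost in
/-- **STUB 2 of line `mirror-akn-two-arm-import` (`MirrorTwoGhost`).** For every `p` and `n`:
the `P_p`-probability that the upper half-space cluster of `e₀ = Pi.single 0 1` (steps inside
`{1 ≤ x 0}`) and the lower half-space cluster of `0` (steps inside `{x 0 ≤ 0}`) both have at least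
`n` vertices while the bulk clusters of `0` and `e₀` are distinct is at most the `P_p`-probability
of Hutchcroft's two-cluster event `𝒮_{e,n}` at the edge `e = s(0, e₀)` (the event of
`Hutchcroft2020_twoGhost_corollary`, `d = 3`, `x = 0`, `y = e₀`). The inclusion of events holds on
the almost sure event "at most one infinite open cluster"
(`Grimmett1999_numInfiniteClusters_le_one_holds`): the edge `e` is closed since `0 ↮ e₀`;
constrained clusters lie in bulk clusters and `v ↦ s(v, v + e₀)` injects sites into incident
lattice edges (`encard_le_encard_edges_meeting`); two infinite bulk clusters would coincide
(`mem_openConn_of_numInfiniteClusters_le_one`). -/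
theorem stub_mirrorTwoGhost :
    ∀ (p : unitInterval) (n : ℕ), (bondPercolation (zdGraph 3) p).real ({ω | (n : ℕ∞) ≤ (openClusterIn (withinGraph (zdGraph 3) {x : Site 3 | 1 ≤ x 0}) ω (Pi.single 0 1)).encard} ∩ {ω | (n : ℕ∞) ≤ (openClusterIn (withinGraph (zdGraph 3) {x : Site 3 | x 0 ≤ 0}) ω 0).encard} ∩ {ω | ¬ (openGraph ω).Reachable (0 : Site 3) (Pi.single 0 1)}) ≤ (bondPercolation (zdGraph 3) p).real {ω | s((0 : Site 3), (Pi.single 0 1 : Site 3)) ∉ ω ∧ ¬ (openGraph ω).Reachable (0 : Site 3) (Pi.single 0 1) ∧ (n : ℕ∞) ≤ {e ∈ (zdGraph 3).edgeSet | ∃ v ∈ e, v ∈ openCluster ω (0 : Site 3)}.encard ∧ (n : ℕ∞) ≤ {e ∈ (zdGraph 3).edgeSet | ∃ v ∈ e, v ∈ openCluster ω (Pi.single 0 1 : Site 3)}.encard ∧ ((openCluster ω (0 : Site 3)).Finite ∨ (openCluster ω (Pi.single 0 1 : Site 3)).Finite)} := by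
  intro p n
  refine ENNReal.toReal_mono (measure_ne_top _ _) (measure_mono_ae ?_)
  filter_upwards [Grimmett1999_numInfiniteClusters_le_one_holds 3 p] with ω hN
  rintro ⟨⟨hUp : (n : ℕ∞) ≤ _, hDn : (n : ℕ∞) ≤ _⟩, hdis : ¬ _⟩
  refine ⟨fun he => hdis ((openGraph_adj ω _ _).2 ⟨he, zero_ne_e0⟩).reachable, hdis,
    le_trans hDn (encard_le_encard_edges_meeting 0 (openClusterIn_subset_openCluster _ ω _)),
    le_trans hUp (encard_le_encard_edges_meeting 0 (openClusterIn_subset_openCluster _ ω _)), ?_⟩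
  by_contra h
  obtain ⟨h0, h1⟩ := not_or.1 h
  exact hdis (mem_openConn_of_numInfiniteClusters_le_one (x := (0 : Site 3))
    (y := (Pi.single 0 1 : Site 3)) hN h0 h1)

end Summit.CriticalPhenomena.PercolationContinuityZ3.Theorems

end
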